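import Summits.ABC.ABC.Theses.DefiniteXi
import Summits.ABC.ABC.Theorems.DefiniteXiDefiniteRTControlPrimeOfTakahashi
import Summits.ABC.ABC.Theorems.IsogenyGlueCongruenceMazurKenkuBoundOfRadius
import Summits.ABC.ABC.Theorems.IsogenyGlueCongruenceMazurKenkuBoundSplitGlue
import Summits.ABC.ABC.Theorems.IsogenyGlueCongruenceKenkuCompositeTables
import Summits.ABC.ABC.Theorems.IsogenyGlueCongruenceKenkuLevelFortyNine
import Summits.ABC.ABC.Theorems.IsogenyGlueCongruenceKenkuPrintedLevelsOfThreeLevels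
import HarnessLib

/-!
# STUB-IDEAS k1 · gen 20 companion — typed doors for `stub_pasten163`
(crux stmt-ABC-11338 `DefiniteXi.DefiniteRTControlPrime`; stub signature
`PastenShimura2024_minimalDegree_le_163_mul`). Scratch only (ideation seat): every declaration is a
one-line import from a LANDED theorem; zero `sorry`. New at gen 20: D5/D6, the import map down to the
two OPEN split children of item stmt-ABC-15125 in route IsogenyGlueCongruence (MazurCor44 = stmt-ABC-18223,
KenkuPrintedLevels = stmt-ABC-18224; the other two children and the glue are PROVED), and to the four
residual named inputs (Mazur Cor. 4.4, Klein–Fricke 13, seven prime `j`-tables, levels 65/125/169).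
-/

set_option linter.dupNamespace false

namespace Summit.ABC.ABC.Cruxes.DefiniteRTControlPrime.StubIdeasK1G20

open WeierstrassCurve
open Literature.NumberTheory.EllipticCurves Literature.NumberTheory.EllipticCurves.ModularForms

/-- D0 · TREE MATCH: the stub is route item `MazurKenkuBound` verbatim — both copies
(DefiniteXi: stmt-ABC-15125 as `aside`; IsogenyGlueCongruence: stmt-ABC-15125 as crux r9, SPLIT). -/
theorem door_item_defeq :
    Summit.ABC.ABC.Theses.DefiniteXi.MazurKenkuBound ↔ PastenShimura2024_minimalDegree_le_163_mul :=
  Iff.rfl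

theorem door_item_defeq' :
    Summit.ABC.ABC.Theses.IsogenyGlueCongruence.MazurKenkuBound ↔
      PastenShimura2024_minimalDegree_le_163_mul :=
  Iff.rfl

/-- D1 · import from item stmt-ABC-15125 (the whole verbatim stub, once that item closes). -/
theorem stub_pasten163_of_item (h : Summit.ABC.ABC.Theses.IsogenyGlueCongruence.MazurKenkuBound) :
    PastenShimura2024_minimalDegree_le_163_mul := h

/-- D2 · import from the RADIUS item stmt-ABC-15193 (Edixhoven integrality stmt-ABC-15990 PROVED). -/
theorem stub_pasten163_of_radius
    (hRad : Summit.ABC.ABC.Theses.RibetTakahashiSplit.MazurKenkuRadius) :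
    PastenShimura2024_minimalDegree_le_163_mul :=
  Summit.ABC.ABC.Theorems.mazurKenkuBound_of_radiusItem hRad

/-- D5 (NEW, gen 20) · import from the two OPEN split children of stmt-ABC-15125 in route
IsogenyGlueCongruence: `MazurCor44` (stmt-ABC-18223, Mazur 1978 Cor. 4.4 — Eisenstein quotient, XL) and
`KenkuPrintedLevels` (stmt-ABC-18224); the children `KenkuCompositeTables` (stmt-ABC-18225) and
`KenkuLevelFortyNine` (stmt-ABC-18226) and the glue `MazurKenkuBoundGlue` (stmt-ABC-18227) are PROVED. -/
theorem stub_pasten163_of_split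
    (h44 : Summit.ABC.ABC.Theses.IsogenyGlueCongruence.MazurCor44)
    (hK : Summit.ABC.ABC.Theses.IsogenyGlueCongruence.KenkuPrintedLevels) :
    PastenShimura2024_minimalDegree_le_163_mul :=
  Summit.ABC.ABC.Theorems.mazurKenkuBoundGlue_proof h44 hK
    Summit.ABC.ABC.Theorems.kenkuCompositeTables_proof
    Summit.ABC.ABC.Theorems.kenkuLevelFortyNine_proof

/-- D6 (NEW, gen 20) · the finest typed import map in the tree: the stub from exactly four residual
named inputs — Mazur Cor. 4.4 (item stmt-ABC-18223), Klein–Fricke at `13` (cite-only Literature fact),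
the seven prime `j`-tables `p ∈ {11,17,19,37,43,67,163}` (rational points of `X₀(p)`), and the three
levels `65, 125, 169` (only cusps) — via the landed
`mazurKenkuBound_of_cor44_of_kleinFricke13_of_primeTables_of_threeLevels`. -/
theorem stub_pasten163_of_threeLevels
    (h44 : Summit.ABC.ABC.Theses.IsogenyGlueCongruence.MazurCor44)
    (h13 : kleinFrickeThirteen_exists_j_eq)
    (hT7 : ∀ (V V' : WeierstrassCurve ℚ) [V.IsElliptic] [V'.IsElliptic] (ψ : Isogeny V V'),
      ψ.IsCyclic → ψ.degree ∈ ({11, 17, 19, 37, 43, 67, 163} : Finset ℕ) →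
        (ψ.degree, V.j) ∈ ({((11 : ℕ), (-32768 : ℚ)), (11, -121), (11, -24729001),
          (17, -297756989 / 2), (17, -882216989 / 131072), (19, -884736), (37, -9317),
          (37, -162677523113838677), (43, -884736000), (67, -147197952000),
          (163, -262537412640768000)} : Finset (ℕ × ℚ)))
    (hL3 : ∀ (V V' : WeierstrassCurve ℚ) [V.IsElliptic] [V'.IsElliptic] (ψ : Isogeny V V'),
      ψ.IsCyclic → ψ.degree ∉ ({65, 125, 169} : Finset ℕ)) :
    PastenShimura2024_minimalDegree_le_163_mul :=
  Summit.ABC.ABC.Theorems.mazurKenkuBound_of_cor44_of_kleinFricke13_of_primeTables_of_threeLevels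
    h44 h13 hT7 hL3

/-- I1 · IDLENESS: the crux BY NAME from Takahashi 2001 Thm 2.3 (coprime form) ALONE — landed
p839521; `stub_pasten163` occurs on no closing path of the crux. -/
theorem crux_of_takahashi :
    takahashi2001_thm_2_3_of_coprime → Summit.ABC.ABC.Theses.DefiniteXi.DefiniteRTControlPrime :=
  Summit.ABC.ABC.Theorems.DefiniteRTControlPrime.definiteRTControlPrime_of_takahashi

#print axioms stub_pasten163_of_split
#print axioms stub_pasten163_of_threeLevels
#print axioms crux_of_takahashi

end Summit.ABC.ABC.Cruxes.DefiniteRTControlPrime.StubIdeasK1G20
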